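import Summits.CriticalPhenomena.CardyFormulaZ2.Theorems.CardyComplexConeEdgePrecompactUFRSStrandsArmsCrossing
import Summits.CriticalPhenomena.CardyFormulaZ2.Theorems.CardyComplexConeEdgePrecompactUFRSStrandsArmsTight
import Summits.CriticalPhenomena.CardyFormulaZ2.Theorems.CardyComplexConeEdgePrecompactUFRSStrandsArmsSectors
import Summits.CriticalPhenomena.CardyFormulaZ2.Theorems.CardyComplexConeEdgePrecompactUFRSEvents
import Summits.CriticalPhenomena.CardyFormulaZ2.Theorems.CardyComplexConeEdgePrecompactUFRSStrands
import Literature.Topology.PlaneTopology.AnnulusArcs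

/-!
# Strands ⇒ arms: corner-disjoint orbit stretches across an annulus give alternating arms
(line `qkz-strip-boundary-arm` of crux `CardyComplexCone.EdgePrecompact`, stmt-CriticalPhenomena-11387;
registered sub-goal `ufrs_strands_zdDomArms`, item 5 of the corrected road map for the uniform
forward response stability "UFRS", `…EdgePrecompactUFRSAnnulusCrossings.lean`)

**Theorem** (`ufrs_strands_zdDomArms`). In ANY configuration `β`, `k ≥ 2` stretches of orbits of
Smirnov's successor map, pairwise sharing no corner, each joining the `r`-ball of `z` to distance
`≥ R ≥ r + 16δ` (either direction), give `β ∈ ufrsArms δ z k r R`: `k` arms across `A(z; r, R)`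
(tolerance `4δ`), not all of one colour, same-colour arms edge-disjoint.

**Why this is not the naive assignment.** Every stretch keeps an open walk on its left and a
dual walk on its right (`exists_orbitArms`), but two corner-disjoint stretches may pass through
the same medial vertex (the two in-darts of an edge), following an open edge on its two sides or
crossing a closed edge at its two ends: their left (resp. right) walks then SHARE that edge.

**Proof (sectors, Aizenman–Burchard).** Mesh `1` after rescaling. Draw the stretches as perturbed
polylines (`…UFRSStrandsArmsPieces.lean`); corner-disjoint stretches of one configuration have
disjoint polylines (`ufrs_piecesMeet`). Trim each to a tight arc `Tₐ` across the annulus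
`[r + 1/2, R - 1/2]` with a middle dart `mₐ` and a chain of corners whose vertices and face centres
stay in `(r + 1, R - 1)` (`strand_tightArc`). In the open annulus minus ALL polylines let `Lₐ`,
`Rₐ` be the components of the vertex and of the face centre of `mₐ`. The chain's open edges and
closed dual steps miss every polyline (`openEdge_not_mem_piece`, `crossSeg_not_mem_piece`), so the
left walk of the chain lives in `Lₐ` and its right walk in `Rₐ`; the half-diagonal of `mₐ` shows
that `Tₐ` touches the closures of `Lₐ` and `Rₐ`. By the three-arcs lemma
(`PlaneTopology.not_three_arcs_touch`) no component is touched by three arcs, so `a ↦ Lₐ` and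
`a ↦ Rₐ` have fibres of size `≤ 2`: there are `≥ k/2` distinct left sectors and `≥ k/2` distinct
right sectors. Left walks in distinct left sectors are edge-disjoint (a common edge has a common
endpoint, in both sectors), likewise right walks; choosing `n_L ≥ 1` open and `k - n_L ≥ 1` dual
representatives gives the `k` arms.

References: M. Aizenman, A. Burchard, Duke Math. J. 99 (1999), Appendix A, Lemma A.5 (sectors);
S. Smirnov, C. R. Acad. Sci. Paris 333 (2001), §2; P. Nolin, Electron. J. Probab. 13 (2008), §4.
-/

namespace Summit.CriticalPhenomena.CardyFormulaZ2.Cruxes.EdgePrecompact.QkzStripBoundaryArm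

open MeasureTheory Filter Set Metric Complex
open scoped Topology BigOperators Pointwise
open Literature.Probability.LatticeModels Literature.Probability.Percolation
open Literature.Probability.RandomPlanarGeometry (DobrushinDomain)
open Summit.CriticalPhenomena.CardyFormulaZ2.Theses.CardyComplexCone
open Literature.Topology.PlaneTopology

noncomputable section

/-! ## The theorem at mesh `1` -/

/-- **Strands ⇒ arms at mesh `1`** (the content of `ufrs_strands_zdDomArms`, sites read as
Gaussian integers): the sector argument described in the module docstring. -/
theorem strands_arms_one (β : BondConfig (Site 2)) (z : ℂ) (k : ℕ) (c : Fin k → Site 2 × Fin 4)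
    (i j : Fin k → ℕ) {r R : ℝ} (hk : 2 ≤ k) (hr : 0 ≤ r) (hrR : r + 16 ≤ R) (hij : ∀ a, i a ≤ j a)
    (hdir : ∀ a, (dist (Site.toComplex (cornerOrbit β (c a) (i a)).1) z ≤ r ∧
        R ≤ dist (Site.toComplex (cornerOrbit β (c a) (j a)).1) z) ∨
      (R ≤ dist (Site.toComplex (cornerOrbit β (c a) (i a)).1) z ∧
        dist (Site.toComplex (cornerOrbit β (c a) (j a)).1) z ≤ r))
    (hdis : ∀ a b, a ≠ b → ∀ s t, i a ≤ s → s ≤ j a → i b ≤ t → t ≤ j b →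
      cornerOrbit β (c a) s ≠ cornerOrbit β (c b) t) :
    ∃ (κ : Fin k → Bool) (x y : Fin k → Site 2) (W : ∀ a, (zdGraph 2).Walk (x a) (y a)),
      (∃ a b, κ a ≠ κ b) ∧
      (∀ a, dist (Site.toComplex (x a)) z ≤ r + 4 ∧ R - 4 ≤ dist (Site.toComplex (y a)) z ∧
        (∀ u ∈ (W a).support, r - 4 ≤ dist (Site.toComplex u) z ∧ dist (Site.toComplex u) z ≤ R + 4) ∧
        (κ a = true → ∀ e ∈ (W a).edges, e ∈ β) ∧
        (κ a = false → ∀ e ∈ (W a).darts, sepEdge e.fst e.snd ∉ β)) ∧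
      Pairwise (fun a b => κ a = κ b → ∀ e ∈ (W a).edges, e ∉ (W b).edges) := by
  classical
  /- the stretches re-based at their first corner: `O (q a) t = O (c a) (i a + t)`, `t ≤ n a` -/
  set q : Fin k → Site 2 × Fin 4 := fun a => cornerOrbit β (c a) (i a) with hq
  set n : Fin k → ℕ := fun a => j a - i a with hn
  have horb : ∀ a t, cornerOrbit β (q a) t = cornerOrbit β (c a) (i a + t) := fun a t =>
    (cornerOrbit_add_eq β (c a) (i a) t).symm
  have hdir' : ∀ a, (dist (Site.toComplex (cornerOrbit β (q a) 0).1) z ≤ r ∧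
        R ≤ dist (Site.toComplex (cornerOrbit β (q a) (n a)).1) z) ∨
      (R ≤ dist (Site.toComplex (cornerOrbit β (q a) 0).1) z ∧
        dist (Site.toComplex (cornerOrbit β (q a) (n a)).1) z ≤ r) := by
    intro a
    rw [horb, horb, add_zero, show i a + n a = j a from Nat.add_sub_cancel' (hij a)]
    exact hdir a
  /- per-strand data: tight arc, middle dart, chain -/
  choose E F T m i' j' hEd hFd htight hTsub hmT hmstrict hi'm hmj' hj'n hchain hends using
    fun a => strand_tightArc β (q a) (n a) z hrR (hdir' a)
  /- the obstacle: all pieces of all stretches -/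
  set K : Set ℂ := ⋃ a, ⋃ jj ∈ Finset.range (2 * n a + 1),
    segment ℝ (pieceVert β (q a) jj) (pieceVert β (q a) (jj + 1)) with hK
  have hKc : IsClosed K := by
    refine isClosed_iUnion_of_finite fun a => isClosed_biUnion_finset fun jj _ => ?_
    rw [← Path.range_segment]
    exact (isCompact_range (Path.segment _ _).continuous).isClosed
  have hmemK : ∀ {w : ℂ}, w ∈ K ↔ ∃ a jj, jj ≤ 2 * n a ∧ w ∈ segment ℝ (pieceVert β (q a) jj) (pieceVert β (q a) (jj + 1)) := by
    intro w
    simp only [hK, mem_iUnion, Finset.mem_range, exists_prop]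
    constructor
    · rintro ⟨a, jj, hjj, hw⟩; exact ⟨a, jj, by omega, hw⟩
    · rintro ⟨a, jj, hjj, hw⟩; exact ⟨a, jj, by omega, hw⟩
  have hpieceK : ∀ a jj, jj ≤ 2 * n a → segment ℝ (pieceVert β (q a) jj) (pieceVert β (q a) (jj + 1)) ⊆ K :=
    fun a jj hjj w hw => hmemK.2 ⟨a, jj, hjj, hw⟩
  have hTK : ∀ a, range (T a) ⊆ K := by
    intro a w hw
    obtain ⟨jj, hjj, hw⟩ := mem_iUnion₂.1 (hTsub a hw)
    exact hpieceK a jj (by have := Finset.mem_range.1 hjj; omega) hw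
  have hvert : ∀ u : Site 2, Site.toComplex u ∉ K := fun u hu => by
    obtain ⟨a, jj, -, hw⟩ := hmemK.1 hu
    exact toComplex_not_mem_piece β (q a) u jj hw
  have hcent : ∀ g : Site 2, faceCenter g ∉ K := fun g hg => by
    obtain ⟨a, jj, -, hw⟩ := hmemK.1 hg
    exact faceCenter_not_mem_piece β (q a) g jj hw
  have hKe : ∀ u w : Site 2, (zdGraph 2).Adj u w → s(u, w) ∈ β →
      ∀ P ∈ segment ℝ (Site.toComplex u) (Site.toComplex w), P ∉ K := fun u w hadj huw P hP hPK => by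
    obtain ⟨b, jj, -, hPb⟩ := hmemK.1 hPK
    exact openEdge_not_mem_piece (q b) hadj huw hPb hP
  have hKx : ∀ p : Site 2 × Fin 4, cTgt p ∉ β →
      ∀ P ∈ segment ℝ (faceCenter (cFace p)) (faceCenter (faceAt p.1 (p.2 + 1))), P ∉ K := fun p hp P hP hPK => by
    obtain ⟨b, jj, -, hPb⟩ := hmemK.1 hPK
    exact crossSeg_not_mem_piece (q b) hp hPb hP
  /- pieces of different stretches are disjoint -/
  have hdisj : ∀ a b, a ≠ b → Disjoint (range (T a)) (range (T b)) := by
    intro a b hab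
    refine Set.disjoint_left.2 fun w hw hw' => ?_
    obtain ⟨jj, hjj, hw⟩ := mem_iUnion₂.1 (hTsub a hw)
    obtain ⟨jj', hjj', hw'⟩ := mem_iUnion₂.1 (hTsub b hw')
    have hjj₁ := Finset.mem_range.1 hjj
    have hjj₂ := Finset.mem_range.1 hjj'
    obtain ⟨s, t, hs, ht, hst⟩ := pieces_meet (q a) (q b) hw hw'
    rw [horb, horb] at hst
    have hi := hij a; have hi' := hij b
    exact hdis a b hab (i a + s) (i b + t) (Nat.le_add_right _ _) (by simp only [hn] at hjj₁; omega)
      (Nat.le_add_right _ _) (by simp only [hn] at hjj₂; omega) hst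
  /- the open annulus, the region, the sectors -/
  set U : Set ℂ := {w | r + 1 / 2 < dist w z ∧ dist w z < R - 1 / 2} with hU
  set X : Set ℂ := U \ K with hX
  set cL : Fin k → Set ℂ := fun a => connectedComponentIn X (Site.toComplex (cornerOrbit β (q a) (m a)).1) with hcL
  set cR : Fin k → Set ℂ := fun a => connectedComponentIn X (faceCenter (cFace (cornerOrbit β (q a) (m a)))) with hcR
  have hcc : ∀ a t, i' a ≤ t → t ≤ j' a →
      Site.toComplex (cornerOrbit β (q a) t).1 ∈ cL a ∧ faceCenter (cFace (cornerOrbit β (q a) t)) ∈ cR a :=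
    fun a t h1 h2 => chain_in_component β (q a) z K hvert hcent hKe hKx (hchain a) (hi'm a) (hmj' a) h1 h2
  /- the arcs touch the closures of both sectors of their middle dart -/
  have hprobe : ∀ a, segment ℝ (Site.toComplex (cornerOrbit β (q a) (m a)).1) (faceCenter (cFace (cornerOrbit β (q a) (m a)))) ⊆ U ∧
      (segment ℝ (Site.toComplex (cornerOrbit β (q a) (m a)).1) (faceCenter (cFace (cornerOrbit β (q a) (m a)))) ∩ K).Nonempty ∧
      segment ℝ (Site.toComplex (cornerOrbit β (q a) (m a)).1) (faceCenter (cFace (cornerOrbit β (q a) (m a)))) ∩ K ⊆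
        segment ℝ (sPt (cornerOrbit β (q a) (m a))) (tPt (cornerOrbit β (q a) (m a))) := by
    intro a
    have hc := hchain a (m a) (hi'm a) (hmj' a)
    refine ⟨fun P hP => ?_, ?_, ?_⟩
    · obtain ⟨h1, h2⟩ := segment_annulus ⟨hc.1, hc.2.1⟩ ⟨hc.2.2.1, hc.2.2.2⟩
        (by rw [dist_comm]; exact (dist_faceCenter_vertex_lt _).le.trans (by norm_num)) P hP
      exact ⟨by linarith, by linarith⟩
    · obtain ⟨P, hP, hPo⟩ := exists_mem_dartSeg_mem_openSegment (isCorner_cFace (cornerOrbit β (q a) (m a)))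
      refine ⟨P, openSegment_subset_segment ℝ _ _ hPo, hpieceK a (2 * m a) (by have := hmj' a; have := hj'n a; omega) ?_⟩
      rw [piece_even_eq_cyDart, cyDart_eq]; exact hP
    · rintro w ⟨hw, hwK⟩
      obtain ⟨b, jj, -, hwb⟩ := hmemK.1 hwK
      obtain ⟨s, rfl, hs⟩ := eq_of_mem_piece_halfDiag β (q b) (v := (cornerOrbit β (q a) (m a)).1)
        (k := (cornerOrbit β (q a) (m a)).2) hwb hw
      rw [pieceVert_even, pieceVert_odd, hs] at hwb
      exact hwb
  have htouch : ∀ a, (closure (cL a) ∩ range (T a) ∩ U).Nonempty ∧ (closure (cR a) ∩ range (T a) ∩ U).Nonempty := by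
    intro a
    obtain ⟨hpU, hpne, hpD⟩ := hprobe a
    constructor
    · obtain ⟨P, hPD, hPcl⟩ := exists_mem_closure_of_probe hKc (hvert _) hpU hpne hpD
      exact ⟨P, ⟨hPcl, hmT a hPD⟩, hmstrict a P hPD⟩
    · rw [segment_symm] at hpU hpne hpD
      obtain ⟨P, hPD, hPcl⟩ := exists_mem_closure_of_probe hKc (hcent _) hpU hpne hpD
      exact ⟨P, ⟨hPcl, hmT a hPD⟩, hmstrict a P hPD⟩
  /- no sector is touched by three arcs -/
  have hthree : ∀ (S : Set ℂ), S ⊆ X → IsPreconnected S → ∀ a₁ a₂ a₃ : Fin k, a₁ ≠ a₂ → a₂ ≠ a₃ → a₃ ≠ a₁ →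
      (closure S ∩ range (T a₁) ∩ U).Nonempty → (closure S ∩ range (T a₂) ∩ U).Nonempty →
      (closure S ∩ range (T a₃) ∩ U).Nonempty → False := by
    intro S hSX hS a₁ a₂ a₃ h12 h23 h31 ht1 ht2 ht3
    exact not_three_arcs_touch (by linarith) (by linarith) T hEd hFd
      (fun l u => ⟨(htight l _ ⟨u, rfl⟩).1, (htight l _ ⟨u, rfl⟩).2.1⟩)
      (fun l u hu => (htight l _ ⟨u, rfl⟩).2.2.1 hu) (fun l u hu => (htight l _ ⟨u, rfl⟩).2.2.2 hu) hdisj hS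
      (fun w hw => (hSX hw).1) (fun l => Set.disjoint_left.2 fun w hw hw' => (hSX hw).2 (hTK l hw')) h12 h23 h31
      ht1 ht2 ht3
  have hfibL : ∀ a₁ a₂ a₃ : Fin k, a₁ ≠ a₂ → a₂ ≠ a₃ → a₃ ≠ a₁ → cL a₁ = cL a₂ → cL a₂ = cL a₃ → False := by
    intro a₁ a₂ a₃ h12 h23 h31 e12 e23
    refine hthree (cL a₁) (connectedComponentIn_subset _ _) isPreconnected_connectedComponentIn a₁ a₂ a₃ h12 h23 h31
      (htouch a₁).1 ?_ ?_
    · rw [e12]; exact (htouch a₂).1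
    · rw [e12, e23]; exact (htouch a₃).1
  have hfibR : ∀ a₁ a₂ a₃ : Fin k, a₁ ≠ a₂ → a₂ ≠ a₃ → a₃ ≠ a₁ → cR a₁ = cR a₂ → cR a₂ = cR a₃ → False := by
    intro a₁ a₂ a₃ h12 h23 h31 e12 e23
    refine hthree (cR a₁) (connectedComponentIn_subset _ _) isPreconnected_connectedComponentIn a₁ a₂ a₃ h12 h23 h31
      (htouch a₁).2 ?_ ?_
    · rw [e12]; exact (htouch a₂).2
    · rw [e12, e23]; exact (htouch a₃).2
  /- the walks of the chains and the counting -/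
  choose WL hWLs hWLe using fun s => exists_leftWalk β (q s) (i' s) (j' s) ((hi'm s).trans (hmj' s))
  choose WR hWRs hWRd using fun s => exists_rightWalk β (q s) (i' s) (j' s) ((hi'm s).trans (hmj' s))
  have hface1 : ∀ (g : Site 2) (d : ℝ), dist (faceCenter g) z < d → dist (Site.toComplex g) z ≤ d + 1 := by
    intro g d h
    have hx := dist_toComplex_faceCenter_lt g
    linarith [dist_triangle (Site.toComplex g) (faceCenter g) z]
  have hface2 : ∀ (g : Site 2) (d : ℝ), d < dist (faceCenter g) z → d - 1 ≤ dist (Site.toComplex g) z := by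
    intro g d h
    have hx := dist_toComplex_faceCenter_lt g
    linarith [dist_triangle (faceCenter g) (Site.toComplex g) z, dist_comm (faceCenter g) (Site.toComplex g)]
  refine arms_of_sectors hk β z r R cL cR
    (fun s₁ s₂ P h1 h2 => (connectedComponentIn_eq h1).trans (connectedComponentIn_eq h2).symm)
    (fun s₁ s₂ P h1 h2 => (connectedComponentIn_eq h1).trans (connectedComponentIn_eq h2).symm)
    hfibL hfibR WL WR (fun s u hu => ?_) (fun s e he => ?_) (fun s => ?_) (fun s u hu => ?_) (fun s d hd => ?_) (fun s => ?_)
  · obtain ⟨t, h1, h2, rfl⟩ := hWLs s u hu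
    have hc := hchain s t h1 h2
    exact ⟨(hcc s t h1 h2).1, by linarith [hc.1], by linarith [hc.2.1]⟩
  · obtain ⟨t, -, -, rfl, hopen⟩ := hWLe s e he; exact hopen
  · rcases hends s with ⟨h1, -, h3, -⟩ | ⟨h1, -, h3, -⟩
    · exact Or.inl ⟨by linarith, by linarith⟩
    · exact Or.inr ⟨by linarith, by linarith⟩
  · obtain ⟨t, h1, h2, rfl⟩ := hWRs s u hu
    have hc := hchain s t h1 h2
    exact ⟨(hcc s t h1 h2).2, by linarith [hface2 _ _ hc.2.2.1], by linarith [hface1 _ _ hc.2.2.2]⟩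
  · obtain ⟨t, -, -, hsep, hclosed⟩ := hWRd s d hd; rw [hsep]; exact hclosed
  · rcases hends s with ⟨-, h2, -, h4⟩ | ⟨-, h2, -, h4⟩
    · exact Or.inl ⟨by linarith [hface1 _ _ h2], by linarith [hface2 _ _ h4]⟩
    · exact Or.inr ⟨by linarith [hface1 _ _ h4], by linarith [hface2 _ _ h2]⟩

/-! ## The registered statement (mesh `δ`) -/

/-- **STRANDS ⇒ ARMS** (registered sub-goal `ufrs_strands_zdDomArms` of stmt-CriticalPhenomena-11387,
item 5 of the corrected UFRS road map): in ANY configuration `β`, `k ≥ 2` orbit stretches of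
Smirnov's successor map, pairwise sharing no corner, each joining the `r`-ball of `z` to distance
`≥ R` (either direction), with `r + 16δ ≤ R`, give `β ∈ ufrsArms δ z k r R` — `k` arms across
`A(z; r, R)` up to the `4δ` tolerance, not all of one colour, same-colour arms edge-disjoint. By
rescaling to mesh `1` (`strands_arms_one`). The simplicity hypothesis on the individual stretches
is not needed. -/
theorem ufrs_strands_zdDomArms : ∀ (β : BondConfig (Site 2)) (δ r R : ℝ) (z : ℂ) (k : ℕ) (c : Fin k → Site 2 × Fin 4) (i j : Fin k → ℕ), 2 ≤ k → 0 < δ → 0 ≤ r → r + 16 * δ ≤ R → (∀ a, i a ≤ j a) → (∀ a, (dist (meshPoint δ (cornerOrbit β (c a) (i a)).1) z ≤ r ∧ R ≤ dist (meshPoint δ (cornerOrbit β (c a) (j a)).1) z) ∨ (R ≤ dist (meshPoint δ (cornerOrbit β (c a) (i a)).1) z ∧ dist (meshPoint δ (cornerOrbit β (c a) (j a)).1) z ≤ r)) → (∀ a s t, i a ≤ s → s < t → t ≤ j a → cornerOrbit β (c a) s ≠ cornerOrbit β (c a) t) → (∀ a b, a ≠ b → ∀ s t, i a ≤ s → s ≤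 j a → i b ≤ t → t ≤ j b → cornerOrbit β (c a) s ≠ cornerOrbit β (c b) t) → β ∈ ufrsArms δ z k r R := by
  intro β δ r R z k c i j hk hδ hr hrR hij hdir _ hdis
  set z' : ℂ := (δ : ℂ)⁻¹ * z with hz'
  have hδ0 : (δ : ℂ) ≠ 0 := ofReal_ne_zero.2 hδ.ne'
  have hdist : ∀ v : Site 2, dist (meshPoint δ v) z = δ * dist (Site.toComplex v) z' := by
    intro v
    rw [dist_eq_norm, dist_eq_norm, show meshPoint δ v - z = (δ : ℂ) * (Site.toComplex v - z') by
      rw [hz', mul_sub, mul_inv_cancel_left₀ hδ0]; rfl, norm_mul, Complex.norm_of_nonneg hδ.le]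
  have hle : ∀ (v : Site 2) (b : ℝ), dist (meshPoint δ v) z ≤ b ↔ dist (Site.toComplex v) z' ≤ b / δ := by
    intro v b; rw [hdist, le_div_iff₀ hδ, mul_comm]
  have hge : ∀ (v : Site 2) (b : ℝ), b ≤ dist (meshPoint δ v) z ↔ b / δ ≤ dist (Site.toComplex v) z' := by
    intro v b; rw [hdist, div_le_iff₀ hδ, mul_comm]
  have hrR' : r / δ + 16 ≤ R / δ := by
    have := div_le_div_of_nonneg_right hrR hδ.le
    rwa [add_div, mul_div_cancel_right₀ _ hδ.ne'] at this
  obtain ⟨κ, x, y, W, hne, harm, hpair⟩ := strands_arms_one β z' k c i j hk (div_nonneg hr hδ.le) hrR' hij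
    (fun a => (hdir a).imp (fun h => ⟨(hle _ _).1 h.1, (hge _ _).1 h.2⟩) (fun h => ⟨(hge _ _).1 h.1, (hle _ _).1 h.2⟩)) hdis
  rw [mem_ufrsArms_iff]
  refine ⟨κ, x, y, W, hne, fun a => ?_, hpair⟩
  obtain ⟨h1, h2, h3, h4, h5⟩ := harm a
  have e1 : (r + 4 * δ) / δ = r / δ + 4 := by rw [add_div, mul_div_cancel_right₀ _ hδ.ne']
  have e2 : (R - 4 * δ) / δ = R / δ - 4 := by rw [sub_div, mul_div_cancel_right₀ _ hδ.ne']
  have e3 : (r - 4 * δ) / δ = r / δ - 4 := by rw [sub_div, mul_div_cancel_right₀ _ hδ.ne']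
  have e4 : (R + 4 * δ) / δ = R / δ + 4 := by rw [add_div, mul_div_cancel_right₀ _ hδ.ne']
  refine ⟨(hle _ _).2 (by rw [e1]; exact h1), (hge _ _).2 (by rw [e2]; exact h2), fun u hu => ?_, h4, h5⟩
  exact ⟨(hge _ _).2 (by rw [e3]; exact (h3 u hu).1), (hle _ _).2 (by rw [e4]; exact (h3 u hu).2)⟩

end

end Summit.CriticalPhenomena.CardyFormulaZ2.Cruxes.EdgePrecompact.QkzStripBoundaryArm
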